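import Summits.QuantumFields.BalabanUV.InfraRed.StrongCouplingSharpTwist
import Literature.MathematicalPhysics.QuantumFieldTheory.Balaban1983to89.StrongCouplingVarianceWindow
import HarnessLib

/-!
# Strong-coupling front, J-SC16d: calculus on `SU(2) ≅ S³` in quaternion coordinates (sphere integration by
parts, tangential trace, the divergence identity in polar form) —
observatory of the non-perturbative crossover; no mass-gap claim

IR-3 v2 TWO-FRONT CROSSOVER LEDGER, front SC (`β₀`), SU(2), `d = 4`, Wilson normalisation `β_W = 4/g²`.
ABSOLUTE RULE of this package: No internally-minted statement may enter as a cited fact. Every hypothesis is either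
kernel-proved in this package or a verbatim quotation of a PUBLISHED theorem with page reference. The manuscript(s)
under audit are NOT citable for their own disputed steps — they are the thing under adjudication; programme-internal
(2001/route/tribunal) claims are never citable. Nothing is cited in this file: every statement is elementary and
proved here ([folklore] labels are attributions, not citations).

WHAT THIS FILE PROVES (the geometric engine of the kernel port of the ball-flux certificate for
`QuarterCovariance`, FRONT-SC §3n step 1 = "LEMMA F′", in the ITERATED form recommended there: polar coordinates
`(0,1] × SU(2)`, Haar measure as the sphere measure, no Lebesgue measure on `ℝ⁴`, no Gauss–Green theorem):
* `quatOfMat` — the first-row quaternion of a `2 × 2` complex matrix as an `ℝ`-linear map (`= su2Quat` on `SU(2)`),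
  and `matD_comp_quatOfMat`: the tree's left-invariant frame derivative `D_{quatMatrix u}` of `G ∘ quatOfMat` at
  `g` is the derivative of `G : ℍ → ℝ` at `x = su2Quat g` in the direction `x·u` (right multiplication by a pure
  imaginary quaternion = a tangent vector field of `S³`);
* `integral_fderiv_mul_right_eq_zero` — **integration by parts on `S³` in quaternion coordinates**:
  `∫ dG(x)[x·u] dσ = 0` for smooth `G : ℍ → ℝ` and pure imaginary `u` (the tree's `integral_matD_eq_zero`);
* `integral_inner_fderiv_tangent` — the **tangential trace identity** `∫ ⟪dW(x)[x·u], x·u⟫ dσ = ∫ ⟪W x, x⟫ dσ`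
  for smooth `W : ℍ → ℍ` and a pure imaginary UNIT `u` (so, summed over `u = i, j, k`, the tangential part of the
  divergence integrates to `3 ∫ ⟪W, x⟫`);
* `integral_inner_eq_integral_radialDiv` — the **divergence identity in polar form**:
  `∫ ⟪W x, x⟫ dσ = ∫₀¹ r · (∫ radialDiv W (r x) dσ) dr`, where
  `radialDiv W y = ⟪dW(y)y, y⟫ + Σ_{u = i,j,k} ⟪dW(y)[y·u], y·u⟫ = |y|² div W(y)` — i.e.
  `⨍_{S³} ⟪W, n⟫ = (1/|S³|) ∫_{B⁴} div W` written without Lebesgue measure.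
METHOD: chain rule through the linear map `quatOfMat`, the tree's IBP `integral_matD_eq_zero` for the `𝔰𝔲(2)`
element `quatMatrix u`, the product rule for `⟪W x, x·u⟫` with `u² = -1`, the fundamental theorem of calculus in
the radius for each fixed direction and Fubini on `SU(2) × [0,1]`.  No smallness, no numerics.

NOT CLAIMED: anything about tilted measures or Lipschitz test functions; no mass-gap claim.
-/

noncomputable section

open MeasureTheory Filter Finset Real
open scoped NNReal Quaternion Matrix ComplexConjugate BigOperators Matrix.Norms.Frobenius ContDiff Topology
  RealInnerProductSpace
open Matrix Complex
open Literature.MathematicalPhysics.QuantumLattice (su2Quat quatMatrix quatMatrix_mul quatMatrix_su2Quat norm_su2Quat)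
open Literature.MathematicalPhysics.QuantumFieldTheory
open Literature.MathematicalPhysics.QuantumFieldTheory.SUNBakryEmery
open Literature.MathematicalPhysics.QuantumFieldTheory.Balaban1983to89.StrongCouplingVarianceWindow (qI qJ qK)

namespace Summit.QuantumFields.BalabanUV.InfraRed.StrongCouplingSphereCalculus

local notation "SU2" => Matrix.specialUnitaryGroup (Fin 2) ℂ
local notation "M₂" => Matrix (Fin 2) (Fin 2) ℂ
local notation "σ₂" => haarProbability (Matrix.specialUnitaryGroup (Fin 2) ℂ)

/-! ## The first-row quaternion of a matrix -/

/-- The quaternion `re Q₀₀ + im Q₀₀·i + re Q₀₁·j + im Q₀₁·k` of a `2 × 2` complex matrix, as an `ℝ`-linear map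
(on `SU(2)` it is the tree's `su2Quat`, and it is a left inverse of `quatMatrix`). [folklore] -/
def quatOfMat : M₂ →ₗ[ℝ] ℍ where
  toFun Q := ⟨(Q 0 0).re, (Q 0 0).im, (Q 0 1).re, (Q 0 1).im⟩
  map_add' P Q := by ext <;> simp
  map_smul' r Q := by ext <;> simp

/-- On `SU(2)`, `quatOfMat` is `su2Quat`. [folklore] -/
@[simp] theorem quatOfMat_coe (g : SU2) : quatOfMat (g : M₂) = su2Quat g := rfl

/-- `quatOfMat` is a left inverse of `quatMatrix`. [folklore] -/
@[simp] theorem quatOfMat_quatMatrix (x : ℍ) : quatOfMat (quatMatrix x) = x := by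
  ext <;> simp [quatOfMat, quatMatrix]

/-- `quatOfMat (g · quatMatrix u) = su2Quat g · u`: right multiplication in `SU(2)` is right multiplication of
quaternions. [folklore] -/
theorem quatOfMat_coe_mul_quatMatrix (g : SU2) (u : ℍ) :
    quatOfMat ((g : M₂) * quatMatrix u) = su2Quat g * u := by
  rw [← quatMatrix_su2Quat g, ← quatMatrix_mul, quatOfMat_quatMatrix]

/-- For a pure imaginary quaternion `u`, `quatMatrix u` is skew-Hermitian … [folklore] -/
theorem quatMatrix_conjTranspose_of_re_eq_zero {u : ℍ} (hu : u.re = 0) : (quatMatrix u)ᴴ = -quatMatrix u := by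
  ext i j
  fin_cases i <;> fin_cases j <;> apply Complex.ext <;> simp [quatMatrix, Matrix.conjTranspose_apply, hu]

/-- … and traceless, i.e. `quatMatrix u ∈ 𝔰𝔲(2)`. [folklore] -/
theorem quatMatrix_trace_of_re_eq_zero {u : ℍ} (hu : u.re = 0) : (quatMatrix u).trace = 0 := by
  rw [Matrix.trace_fin_two]
  apply Complex.ext <;> simp [quatMatrix, hu]

/-! ## The frame derivative in quaternion coordinates -/

section Calculus

attribute [local instance 2000] matTop

/-- `quatOfMat` as a continuous linear map. [folklore] -/
def quatOfMatL : M₂ →L[ℝ] ℍ := LinearMap.toContinuousLinearMap quatOfMat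

/-- `quatOfMatL` is `quatOfMat`. [folklore] -/
@[simp] theorem quatOfMatL_apply (Q : M₂) : quatOfMatL Q = quatOfMat Q := rfl

/-- Smoothness of `G ∘ quatOfMat` for smooth `G`. [folklore] -/
theorem contDiff_comp_quatOfMat {G : ℍ → ℝ} (hG : ContDiff ℝ ∞ G) : ContDiff ℝ ∞ (G ∘ quatOfMat) := by
  have h : ContDiff ℝ ∞ (quatOfMatL : M₂ → ℍ) := quatOfMatL.contDiff
  exact hG.comp h

/-- **The frame derivative in quaternion coordinates**: for differentiable `G : ℍ → ℝ`,
`D_{quatMatrix u} (G ∘ quatOfMat) (g) = dG(su2Quat g)[su2Quat g · u]`. [folklore] -/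
theorem matD_comp_quatOfMat {G : ℍ → ℝ} (hG : Differentiable ℝ G) (u : ℍ) (g : SU2) :
    matD (quatMatrix u) (G ∘ quatOfMat) (g : M₂) = fderiv ℝ G (su2Quat g) (su2Quat g * u) := by
  rw [matD_apply]
  have h1 : HasFDerivAt (quatOfMatL : M₂ → ℍ) quatOfMatL (g : M₂) := quatOfMatL.hasFDerivAt
  have h2 : HasFDerivAt (G ∘ quatOfMat) ((fderiv ℝ G (quatOfMat (g : M₂))).comp quatOfMatL) (g : M₂) :=
    (hG _).hasFDerivAt.comp _ h1
  rw [h2.fderiv, ContinuousLinearMap.comp_apply, quatOfMatL_apply, quatOfMat_coe_mul_quatMatrix, quatOfMat_coe]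

end Calculus

/-! ## Integration by parts on `S³` in quaternion coordinates -/

/-- **Integration by parts on `SU(2) ≅ S³`**: `∫ dG(x)[x·u] dσ(x) = 0` for every smooth `G : ℍ → ℝ` and every
pure imaginary quaternion `u` (the vector field `x ↦ x·u` is tangent to `S³` and generates the Haar-preserving
right translations). [folklore] -/
theorem integral_fderiv_mul_right_eq_zero {G : ℍ → ℝ} (hG : ContDiff ℝ ∞ G) {u : ℍ} (hu : u.re = 0) :
    ∫ g : SU2, fderiv ℝ G (su2Quat g) (su2Quat g * u) ∂σ₂ = 0 := by
  have h := integral_matD_eq_zero (N := 2) (contDiff_comp_quatOfMat hG) (quatMatrix_conjTranspose_of_re_eq_zero hu)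
    (quatMatrix_trace_of_re_eq_zero hu)
  have hd : Differentiable ℝ G := hG.differentiable (by simp)
  simpa only [matD_comp_quatOfMat hd] using h

/-! ## The tangential trace identity -/

/-- `u² = -1` for a pure imaginary unit quaternion. [folklore] -/
theorem mul_self_of_re_eq_zero {u : ℍ} (hu : u.re = 0) (hu1 : ‖u‖ = 1) : u * u = -1 := by
  have hs : star u = -u := by
    rw [Quaternion.star_eq_two_re_sub, hu]
    simp
  have hn : Quaternion.normSq u = 1 := by
    rw [Quaternion.normSq_eq_norm_mul_self, hu1, mul_one]
  have h := Quaternion.self_mul_star u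
  rw [hs, mul_neg, hn] at h
  have h' : u * u = -((1 : ℝ) : ℍ) := by rw [← h, neg_neg]
  simpa using h'

/-- Continuity of `su2Quat`. [folklore] -/
private theorem continuous_su2Quat' : Continuous (su2Quat : SU2 → ℍ) := by
  have h : Continuous fun g : SU2 => quatOfMat (g : M₂) :=
    (LinearMap.continuous_of_finiteDimensional quatOfMat).comp continuous_subtype_val
  simpa only [quatOfMat_coe] using h

/-- The derivative of `x ↦ ⟪W x, x·u⟫` in the direction `h`: `⟪W x, h·u⟫ + ⟪dW(x) h, x·u⟫`. [folklore] -/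
theorem fderiv_inner_mul_right {W : ℍ → ℍ} (hW : Differentiable ℝ W) (u x h : ℍ) :
    fderiv ℝ (fun y => ⟪W y, y * u⟫) x h = ⟪W x, h * u⟫ + ⟪fderiv ℝ W x h, x * u⟫ := by
  have hWx : HasFDerivAt W (fderiv ℝ W x) x := (hW x).hasFDerivAt
  have e : (fun y : ℍ => y * u) = ⇑((ContinuousLinearMap.mul ℝ ℍ).flip u) := by
    funext y
    simp
  have hm : HasFDerivAt (fun y : ℍ => y * u) ((ContinuousLinearMap.mul ℝ ℍ).flip u) x := by
    rw [e]
    exact ((ContinuousLinearMap.mul ℝ ℍ).flip u).hasFDerivAt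
  have hG := hWx.inner ℝ hm
  rw [hG.fderiv]
  simp

/-- **Tangential trace identity**: for smooth `W : ℍ → ℍ` and a pure imaginary unit quaternion `u`,
`∫ ⟪dW(x)[x·u], x·u⟫ dσ = ∫ ⟪W x, x⟫ dσ` (integration by parts of `⟪W x, x·u⟫` along `x ↦ x·u`, using
`(x·u)·u = -x`). Summed over `u = i, j, k` this is `∫ (tangential divergence of W) dσ = 3 ∫ ⟪W, x⟫ dσ`.
[folklore] -/
theorem integral_inner_fderiv_tangent {W : ℍ → ℍ} (hW : ContDiff ℝ ∞ W) {u : ℍ} (hu : u.re = 0)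
    (hu1 : ‖u‖ = 1) :
    ∫ g : SU2, ⟪fderiv ℝ W (su2Quat g) (su2Quat g * u), su2Quat g * u⟫ ∂σ₂ =
      ∫ g : SU2, ⟪W (su2Quat g), su2Quat g⟫ ∂σ₂ := by
  have hd : Differentiable ℝ W := hW.differentiable (by simp)
  have hG : ContDiff ℝ ∞ (fun y : ℍ => ⟪W y, y * u⟫) := hW.inner ℝ (contDiff_id.mul contDiff_const)
  have h0 := integral_fderiv_mul_right_eq_zero hG hu
  have huu : ∀ x : ℍ, x * u * u = -x := fun x => by
    rw [mul_assoc, mul_self_of_re_eq_zero hu hu1, mul_neg_one]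
  have hpt : ∀ g : SU2, fderiv ℝ (fun y : ℍ => ⟪W y, y * u⟫) (su2Quat g) (su2Quat g * u) =
      ⟪fderiv ℝ W (su2Quat g) (su2Quat g * u), su2Quat g * u⟫ - ⟪W (su2Quat g), su2Quat g⟫ := by
    intro g
    rw [fderiv_inner_mul_right hd, huu, inner_neg_right]
    ring
  simp_rw [hpt] at h0
  have hq := continuous_su2Quat'
  have hWc : Continuous W := hW.continuous
  have hDc : Continuous (fderiv ℝ W) := hW.continuous_fderiv (by simp)
  have i1 : Integrable (fun g : SU2 => ⟪fderiv ℝ W (su2Quat g) (su2Quat g * u), su2Quat g * u⟫) σ₂ := by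
    refine integrable_of_continuous_SUN ?_ _
    exact ((hDc.comp hq).clm_apply (hq.mul continuous_const)).inner (hq.mul continuous_const)
  have i2 : Integrable (fun g : SU2 => ⟪W (su2Quat g), su2Quat g⟫) σ₂ :=
    integrable_of_continuous_SUN ((hWc.comp hq).inner hq) _
  have h1 := integral_sub i1 i2
  rw [h0] at h1
  linarith

/-! ## The divergence identity in polar form -/

/-- `|y|² · div W (y)` computed in the (orthogonal, equal-length) frame `{y, y·i, y·j, y·k}`:
`⟪dW(y) y, y⟫ + Σ_{u = i,j,k} ⟪dW(y)[y·u], y·u⟫`. [folklore] -/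
def radialDiv (W : ℍ → ℍ) (y : ℍ) : ℝ :=
  ⟪fderiv ℝ W y y, y⟫ +
    (⟪fderiv ℝ W y (y * qI), y * qI⟫ + ⟪fderiv ℝ W y (y * qJ), y * qJ⟫ + ⟪fderiv ℝ W y (y * qK), y * qK⟫)

/-- A quaternion with unit coordinate sum of squares has norm one. [folklore] -/
private theorem norm_eq_one_of {u : ℍ} (h : u.re ^ 2 + u.imI ^ 2 + u.imJ ^ 2 + u.imK ^ 2 = 1) : ‖u‖ = 1 := by
  have h1 : ‖u‖ * ‖u‖ = 1 := by
    rw [← Quaternion.normSq_eq_norm_mul_self, Quaternion.normSq_def']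
    exact h
  nlinarith [norm_nonneg u]
/-- `‖i‖ = 1` (the tree's `qI`). [folklore] -/
private theorem norm_qI' : ‖qI‖ = 1 := norm_eq_one_of (by simp [qI])
/-- `‖j‖ = 1` (the tree's `qJ`). [folklore] -/
private theorem norm_qJ' : ‖qJ‖ = 1 := norm_eq_one_of (by simp [qJ])
/-- `‖k‖ = 1` (the tree's `qK`). [folklore] -/
private theorem norm_qK' : ‖qK‖ = 1 := norm_eq_one_of (by simp [qK])

/-- The radial derivative: `d/dr [r³ ⟪W(r x), x⟫] = 3r² ⟪W(r x), x⟫ + r³ ⟪dW(r x) x, x⟫`. [folklore] -/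
theorem hasDerivAt_cube_mul_inner {W : ℍ → ℍ} (hW : Differentiable ℝ W) (x : ℍ) (r : ℝ) :
    HasDerivAt (fun r : ℝ => r ^ 3 * ⟪W (r • x), x⟫)
      (3 * r ^ 2 * ⟪W (r • x), x⟫ + r ^ 3 * ⟪fderiv ℝ W (r • x) x, x⟫) r := by
  have h1 : HasDerivAt (fun r : ℝ => r • x) x r := by
    simpa using (hasDerivAt_id r).smul_const x
  have h2 : HasDerivAt (fun r : ℝ => W (r • x)) (fderiv ℝ W (r • x) x) r :=
    (hW (r • x)).hasFDerivAt.comp_hasDerivAt r h1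
  have h3 : HasDerivAt (fun r : ℝ => ⟪W (r • x), x⟫) ⟪fderiv ℝ W (r • x) x, x⟫ r := by
    have h := h2.inner ℝ (hasDerivAt_const r x)
    simpa using h
  have h4 : HasDerivAt (fun r : ℝ => r ^ 3) (3 * r ^ 2) r := by
    simpa using hasDerivAt_pow 3 r
  exact h4.mul h3

/-- The fundamental theorem of calculus along a ray:
`∫₀¹ (3r² ⟪W(r x), x⟫ + r³ ⟪dW(r x) x, x⟫) dr = ⟪W x, x⟫`. [folklore] -/
theorem integral_radial_deriv {W : ℍ → ℍ} (hW : ContDiff ℝ ∞ W) (x : ℍ) :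
    ∫ r in (0 : ℝ)..1, (3 * r ^ 2 * ⟪W (r • x), x⟫ + r ^ 3 * ⟪fderiv ℝ W (r • x) x, x⟫) = ⟪W x, x⟫ := by
  have hd : Differentiable ℝ W := hW.differentiable (by simp)
  have hWc : Continuous W := hW.continuous
  have hDc : Continuous (fderiv ℝ W) := hW.continuous_fderiv (by simp)
  have hsm : Continuous fun r : ℝ => r • x := continuous_id.smul continuous_const
  have hcont : Continuous fun r : ℝ => 3 * r ^ 2 * ⟪W (r • x), x⟫ + r ^ 3 * ⟪fderiv ℝ W (r • x) x, x⟫ := by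
    refine ((continuous_const.mul (continuous_id.pow 2)).mul ((hWc.comp hsm).inner continuous_const)).add
      ((continuous_id.pow 3).mul (((hDc.comp hsm).clm_apply continuous_const).inner continuous_const))
  have h := intervalIntegral.integral_eq_sub_of_hasDerivAt (a := (0 : ℝ)) (b := 1)
    (f := fun r : ℝ => r ^ 3 * ⟪W (r • x), x⟫)
    (fun r _ => hasDerivAt_cube_mul_inner hd x r) (hcont.intervalIntegrable _ _)
  rw [h]
  simp

/-- The derivative of the rescaled field `x ↦ W (r x)`. [folklore] -/
theorem fderiv_comp_smul {W : ℍ → ℍ} (hW : Differentiable ℝ W) (r : ℝ) (x h : ℍ) :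
    fderiv ℝ (fun y : ℍ => W (r • y)) x h = r • fderiv ℝ W (r • x) h := by
  have h1 : HasFDerivAt (fun y : ℍ => r • y) (r • ContinuousLinearMap.id ℝ ℍ) x :=
    (hasFDerivAt_id x).const_smul r
  have h2 : HasFDerivAt (fun y : ℍ => W (r • y)) ((fderiv ℝ W (r • x)).comp (r • ContinuousLinearMap.id ℝ ℍ)) x :=
    (hW (r • x)).hasFDerivAt.comp x h1
  rw [h2.fderiv]
  simp

/-- The spherical average of `r · radialDiv W (r x)` is the radial derivative of `r³ ⨍ ⟪W(r x), x⟫`: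
`r ∫ radialDiv W (r x) dσ = ∫ (3r² ⟪W(r x), x⟫ + r³ ⟪dW(r x) x, x⟫) dσ` (the tangential trace identity for the
rescaled field, three times). [folklore] -/
theorem mul_integral_radialDiv {W : ℍ → ℍ} (hW : ContDiff ℝ ∞ W) (r : ℝ) :
    r * ∫ g : SU2, radialDiv W (r • su2Quat g) ∂σ₂ =
      ∫ g : SU2, (3 * r ^ 2 * ⟪W (r • su2Quat g), su2Quat g⟫ +
        r ^ 3 * ⟪fderiv ℝ W (r • su2Quat g) (su2Quat g), su2Quat g⟫) ∂σ₂ := by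
  have hd : Differentiable ℝ W := hW.differentiable (by simp)
  have hWc : Continuous W := hW.continuous
  have hDc : Continuous (fderiv ℝ W) := hW.continuous_fderiv (by simp)
  have hq := continuous_su2Quat'
  -- the rescaled field
  have hWr : ContDiff ℝ ∞ (fun y : ℍ => W (r • y)) := hW.comp (contDiff_const_smul r)
  -- tangential trace identity for the rescaled field, in each of the three frame directions
  have htan : ∀ {u : ℍ}, u.re = 0 → ‖u‖ = 1 →
      r * ∫ g : SU2, ⟪fderiv ℝ W (r • su2Quat g) (su2Quat g * u), su2Quat g * u⟫ ∂σ₂ =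
        ∫ g : SU2, ⟪W (r • su2Quat g), su2Quat g⟫ ∂σ₂ := by
    intro u hu hu1
    have h := integral_inner_fderiv_tangent hWr hu hu1
    simp_rw [fderiv_comp_smul hd, real_inner_smul_left] at h
    rw [integral_const_mul] at h
    exact h
  -- pointwise expansion of `radialDiv` at `r • x`
  have hpt : ∀ g : SU2, radialDiv W (r • su2Quat g) =
      r ^ 2 * ⟪fderiv ℝ W (r • su2Quat g) (su2Quat g), su2Quat g⟫ +
      r ^ 2 * (⟪fderiv ℝ W (r • su2Quat g) (su2Quat g * qI), su2Quat g * qI⟫ +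
        ⟪fderiv ℝ W (r • su2Quat g) (su2Quat g * qJ), su2Quat g * qJ⟫ +
        ⟪fderiv ℝ W (r • su2Quat g) (su2Quat g * qK), su2Quat g * qK⟫) := by
    intro g
    simp only [radialDiv, smul_mul_assoc, map_smul, real_inner_smul_left, real_inner_smul_right]
    ring
  simp_rw [hpt]
  -- integrability of the pieces
  have iR : Integrable (fun g : SU2 => ⟪fderiv ℝ W (r • su2Quat g) (su2Quat g), su2Quat g⟫) σ₂ :=
    integrable_of_continuous_SUN (((hDc.comp (hq.const_smul r)).clm_apply hq).inner hq) _
  have iT : ∀ u : ℍ, Integrable (fun g : SU2 => ⟪fderiv ℝ W (r • su2Quat g) (su2Quat g * u), su2Quat g * u⟫) σ₂ :=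
    fun u => integrable_of_continuous_SUN
      (((hDc.comp (hq.const_smul r)).clm_apply (hq.mul continuous_const)).inner (hq.mul continuous_const)) _
  have iW : Integrable (fun g : SU2 => ⟪W (r • su2Quat g), su2Quat g⟫) σ₂ :=
    integrable_of_continuous_SUN ((hWc.comp (hq.const_smul r)).inner hq) _
  have h1 : Integrable (fun g : SU2 => r ^ 2 * ⟪fderiv ℝ W (r • su2Quat g) (su2Quat g), su2Quat g⟫) σ₂ :=
    iR.const_mul _
  have h3 : Integrable (fun g : SU2 => ⟪fderiv ℝ W (r • su2Quat g) (su2Quat g * qI), su2Quat g * qI⟫ +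
      ⟪fderiv ℝ W (r • su2Quat g) (su2Quat g * qJ), su2Quat g * qJ⟫) σ₂ := (iT qI).add (iT qJ)
  have h4 : Integrable (fun g : SU2 => ⟪fderiv ℝ W (r • su2Quat g) (su2Quat g * qI), su2Quat g * qI⟫ +
      ⟪fderiv ℝ W (r • su2Quat g) (su2Quat g * qJ), su2Quat g * qJ⟫ +
      ⟪fderiv ℝ W (r • su2Quat g) (su2Quat g * qK), su2Quat g * qK⟫) σ₂ := h3.add (iT qK)
  have h2 : Integrable (fun g : SU2 => r ^ 2 * (⟪fderiv ℝ W (r • su2Quat g) (su2Quat g * qI), su2Quat g * qI⟫ +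
      ⟪fderiv ℝ W (r • su2Quat g) (su2Quat g * qJ), su2Quat g * qJ⟫ +
      ⟪fderiv ℝ W (r • su2Quat g) (su2Quat g * qK), su2Quat g * qK⟫)) σ₂ := h4.const_mul _
  have h5 : Integrable (fun g : SU2 => 3 * r ^ 2 * ⟪W (r • su2Quat g), su2Quat g⟫) σ₂ := iW.const_mul _
  have h6 : Integrable (fun g : SU2 => r ^ 3 * ⟪fderiv ℝ W (r • su2Quat g) (su2Quat g), su2Quat g⟫) σ₂ :=
    iR.const_mul _
  rw [integral_add h1 h2, integral_const_mul, integral_const_mul, integral_add h3 (iT qK),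
    integral_add (iT qI) (iT qJ), integral_add h5 h6, integral_const_mul, integral_const_mul]
  have hI := htan (show (qI).re = 0 from rfl) norm_qI'
  have hJ := htan (show (qJ).re = 0 from rfl) norm_qJ'
  have hK := htan (show (qK).re = 0 from rfl) norm_qK'
  -- `r * (r² ΣT) = r² (Σ rT) = 3 r² ∫⟪W(rx),x⟫`
  calc r * (r ^ 2 * ∫ g : SU2, ⟪fderiv ℝ W (r • su2Quat g) (su2Quat g), su2Quat g⟫ ∂σ₂ +
        r ^ 2 * (∫ g : SU2, ⟪fderiv ℝ W (r • su2Quat g) (su2Quat g * qI), su2Quat g * qI⟫ ∂σ₂ +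
          ∫ g : SU2, ⟪fderiv ℝ W (r • su2Quat g) (su2Quat g * qJ), su2Quat g * qJ⟫ ∂σ₂ +
          ∫ g : SU2, ⟪fderiv ℝ W (r • su2Quat g) (su2Quat g * qK), su2Quat g * qK⟫ ∂σ₂))
      = r ^ 3 * ∫ g : SU2, ⟪fderiv ℝ W (r • su2Quat g) (su2Quat g), su2Quat g⟫ ∂σ₂ +
        r ^ 2 * (r * ∫ g : SU2, ⟪fderiv ℝ W (r • su2Quat g) (su2Quat g * qI), su2Quat g * qI⟫ ∂σ₂ +
          r * ∫ g : SU2, ⟪fderiv ℝ W (r • su2Quat g) (su2Quat g * qJ), su2Quat g * qJ⟫ ∂σ₂ +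
          r * ∫ g : SU2, ⟪fderiv ℝ W (r • su2Quat g) (su2Quat g * qK), su2Quat g * qK⟫ ∂σ₂) := by ring
    _ = 3 * r ^ 2 * ∫ g : SU2, ⟪W (r • su2Quat g), su2Quat g⟫ ∂σ₂ +
        r ^ 3 * ∫ g : SU2, ⟪fderiv ℝ W (r • su2Quat g) (su2Quat g), su2Quat g⟫ ∂σ₂ := by
      rw [hI, hJ, hK]; ring

/-- **The divergence identity in polar form ("LEMMA F′" of the flux method, without Lebesgue measure)**:
for every smooth vector field `W : ℍ → ℍ`,
`∫ ⟪W x, x⟫ dσ(x) = ∫₀¹ r · (∫ radialDiv W (r x) dσ(x)) dr`,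
i.e. `⨍_{S³} ⟪W, n⟫ = (1/|S³|) ∫_{B⁴} div W` with the ball integral written in polar coordinates
(`(1/|S³|) ∫_{B⁴} f = ∫₀¹ r³ ⨍_{S³} f(r·) dr` and `radialDiv W (y) = |y|² div W (y)`). Proof: the FTC
along each ray (`integral_radial_deriv`), Fubini on `SU(2) × [0,1]`, and the tangential trace identity at
each radius (`mul_integral_radialDiv`). [folklore] -/
theorem integral_inner_eq_integral_radialDiv {W : ℍ → ℍ} (hW : ContDiff ℝ ∞ W) :
    ∫ g : SU2, ⟪W (su2Quat g), su2Quat g⟫ ∂σ₂ =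
      ∫ r in (0 : ℝ)..1, r * ∫ g : SU2, radialDiv W (r • su2Quat g) ∂σ₂ := by
  have hWc : Continuous W := hW.continuous
  have hDc : Continuous (fderiv ℝ W) := hW.continuous_fderiv (by simp)
  have hq := continuous_su2Quat'
  -- the radial derivative as a function on `SU(2) × ℝ`
  set F : SU2 → ℝ → ℝ := fun g r => 3 * r ^ 2 * ⟪W (r • su2Quat g), su2Quat g⟫ +
    r ^ 3 * ⟪fderiv ℝ W (r • su2Quat g) (su2Quat g), su2Quat g⟫ with hF
  -- step 1: FTC along each ray
  have h1 : ∫ g : SU2, ⟪W (su2Quat g), su2Quat g⟫ ∂σ₂ = ∫ g : SU2, (∫ r in (0 : ℝ)..1, F g r) ∂σ₂ := by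
    refine integral_congr_ae (ae_of_all _ fun g => ?_)
    simp only [hF]
    exact (integral_radial_deriv hW (su2Quat g)).symm
  -- step 3: the tangential trace identity at each radius
  have h3 : ∀ r : ℝ, ∫ g : SU2, F g r ∂σ₂ = r * ∫ g : SU2, radialDiv W (r • su2Quat g) ∂σ₂ := by
    intro r
    simp only [hF]
    exact (mul_integral_radialDiv hW r).symm
  -- step 2: Fubini on `SU(2) × [0,1]` (continuous integrand on a compact set)
  have hc : Continuous (Function.uncurry F) := by
    have hx : Continuous fun p : SU2 × ℝ => su2Quat p.1 := hq.comp continuous_fst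
    have hr : Continuous fun p : SU2 × ℝ => p.2 := continuous_snd
    have hrx : Continuous fun p : SU2 × ℝ => p.2 • su2Quat p.1 := hr.smul hx
    have hA : Continuous fun p : SU2 × ℝ => ⟪W (p.2 • su2Quat p.1), su2Quat p.1⟫ := (hWc.comp hrx).inner hx
    have hB : Continuous fun p : SU2 × ℝ => ⟪fderiv ℝ W (p.2 • su2Quat p.1) (su2Quat p.1), su2Quat p.1⟫ :=
      ((hDc.comp hrx).clm_apply hx).inner hx
    have h : Continuous fun p : SU2 × ℝ => 3 * p.2 ^ 2 * ⟪W (p.2 • su2Quat p.1), su2Quat p.1⟫ +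
        p.2 ^ 3 * ⟪fderiv ℝ W (p.2 • su2Quat p.1) (su2Quat p.1), su2Quat p.1⟫ :=
      ((continuous_const.mul (hr.pow 2)).mul hA).add ((hr.pow 3).mul hB)
    change Continuous fun p : SU2 × ℝ => F p.1 p.2
    simpa only [hF] using h
  have hK : IsCompact ((Set.univ : Set SU2) ×ˢ Set.Icc (0 : ℝ) 1) := isCompact_univ.prod isCompact_Icc
  have hi : IntegrableOn (Function.uncurry F) ((Set.univ : Set SU2) ×ˢ Set.Icc (0 : ℝ) 1) ((σ₂).prod volume) :=
    hc.continuousOn.integrableOn_compact hK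
  have hint : Integrable (Function.uncurry F) ((σ₂).prod (volume.restrict (Set.Icc (0 : ℝ) 1))) := by
    have e : (σ₂).prod (volume.restrict (Set.Icc (0 : ℝ) 1)) =
        ((σ₂).prod volume).restrict ((Set.univ : Set SU2) ×ˢ Set.Icc (0 : ℝ) 1) := by
      rw [← Measure.prod_restrict, Measure.restrict_univ]
    rw [e]
    exact hi
  have h2 : ∫ g : SU2, (∫ r in (0 : ℝ)..1, F g r) ∂σ₂ = ∫ r in (0 : ℝ)..1, (∫ g : SU2, F g r ∂σ₂) := by
    simp_rw [intervalIntegral.integral_of_le zero_le_one, ← integral_Icc_eq_integral_Ioc]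
    exact integral_integral_swap hint
  rw [h1, h2]
  simp_rw [h3]

end Summit.QuantumFields.BalabanUV.InfraRed.StrongCouplingSphereCalculus
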